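import Mathlib
import HarnessLib
import Summits.NavierStokesRegularity.NavierStokesRegularity.Theorems.QuarterLogPincerBeadCensusDefs
import Summits.NavierStokesRegularity.NavierStokesRegularity.Theorems.QuarterLogPincerCubicRungDefs
import Summits.NavierStokesRegularity.NavierStokesRegularity.Theorems.QuarterLogPincerTypeIQuantSubcubicExpFrameTools

/-!
# Route `QuarterLogPincer`, crux `TypeIQuantSubcubicExp` (stmt-NavierStokesRegularity-24077), line `bead_census` —
# the line's PROVED KERNEL, by name

VERBATIM port (bodies byte-identical up to the unfolding of the local notation `E3`) of the sorry-free theorems of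
ns-idea-7's workfile `Cruxes/TypeIQuantSubcubicExp/Lines/bead_census.lean` (v1.2, idea-crit-4 PASS 2026-08-29T04:07Z) over
the landed objects `…QuarterLogPincerBeadCensusDefs` and the rung `…QuarterLogPincerCubicRungDefs` (`CubicRung.QuantCubicExpAt`,
`CubicRung.TypeIQuantCubicExp` — the workfile's §0 copies are replaced by the decls of record): §2 the sub-similar kinematics
of the sup-rate gauge (`displacement_le_of_speed_le_rate`, `outer_region_frozen`), §3♯ `sqrt_levelScale`,
`measurableSet_levelShell`, `levelShell_disjoint`, `censusAt_of_flarePersistenceAt`, `beadCensus_of_flarePersistence`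
(G1♯ ⇒ the census), §4 `quantCubicExpAt_of_censusAt_of_chainAt`, `typeIQuantCubicExp_of_beadCensus_of_bpChainRate`,
`typeIQuantCubicExp_of_flarePersistence_of_bpChainRate` (census + chain ⇒ the rung R).  The stubs (`stub_bpChainRate`,
`stub_flarePersistence`) and their pluggings are NOT ported.  HONEST FRAME: implications between Props about HYPOTHETICAL
Type-I classical solutions; nothing here proves R, the crux, W7 or Navier–Stokes regularity (OPEN / not proved).
pub-ns-dss typer (g38), `--supports stmt-NavierStokesRegularity-24077`; bodies by ns-idea-7 (g11–g12).
-/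

set_option linter.dupNamespace false

namespace Summit.NavierStokesRegularity.NavierStokesRegularity.Cruxes.TypeIQuantSubcubicExp.BeadCensus

noncomputable section

open MeasureTheory Set Function Filter Topology Metric
open scoped ENNReal NNReal Classical
open Literature.Analysis Literature.Analysis.FluidPDE
open Summit.NavierStokesRegularity.NavierStokesRegularity.Theorems.ThinCascade
open Summit.NavierStokesRegularity.NavierStokesRegularity.Cruxes.TypeIQuantSubcubicExp.CubicRung
  (QuantCubicExpAt TypeIQuantCubicExp quantCubicExpAt_antitone)

/-- **Displacement bound.**  A curve `X` on `[t₀, b]` with speed `‖X'(t)‖ ≤ M (T' − t)^{-1/2}` (`b < T'`)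
moves by at most `2M(√(T'−t₀) − √(T'−t)) ≤ 2M√(T'−t₀)` by time `t`.  (Material transport under the
virtual Type-I rate `M(T+τ−t)^{-1/2}`, `T' = T+τ`.) [Mathlib ODE comparison
`image_norm_le_of_norm_deriv_right_le_deriv_boundary`] -/
theorem displacement_le_of_speed_le_rate {X V : ℝ → (EuclideanSpace ℝ (Fin 3))} {t₀ b T' M : ℝ} (hb : b < T')
    (hcont : ContinuousOn X (Icc t₀ b))
    (hderiv : ∀ t ∈ Ico t₀ b, HasDerivWithinAt X (V t) (Ici t) t)
    (hspeed : ∀ t ∈ Ico t₀ b, ‖V t‖ ≤ M * (T' - t) ^ (-(1 / 2 : ℝ))) :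
    ∀ t ∈ Icc t₀ b, ‖X t - X t₀‖ ≤ 2 * M * (Real.sqrt (T' - t₀) - Real.sqrt (T' - t)) := by
  -- boundary function `B t = 2M(√(T'−t₀) − √(T'−t))`, `B' t = M/√(T'−t)`
  have hB : ∀ t ∈ Ico t₀ b, HasDerivWithinAt (fun t => 2 * M * (Real.sqrt (T' - t₀) - Real.sqrt (T' - t)))
      (M * (T' - t) ^ (-(1 / 2 : ℝ))) (Ici t) t := by
    intro t ht
    have htT : 0 < T' - t := by linarith [ht.2]
    have h1 : HasDerivAt (fun s => T' - s) (-1) t := by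
      simpa using (hasDerivAt_id t).const_sub T'
    have h2 : HasDerivAt (fun s => Real.sqrt (T' - s)) ((-1) / (2 * Real.sqrt (T' - t))) t :=
      h1.sqrt htT.ne'
    have h3 : HasDerivAt (fun s => 2 * M * (Real.sqrt (T' - t₀) - Real.sqrt (T' - s)))
        (2 * M * (0 - (-1) / (2 * Real.sqrt (T' - t)))) t :=
      ((hasDerivAt_const t _).sub h2).const_mul _
    have e : 2 * M * (0 - (-1) / (2 * Real.sqrt (T' - t))) = M * (T' - t) ^ (-(1 / 2 : ℝ)) := by
      have hsq : Real.sqrt (T' - t) ≠ 0 := (Real.sqrt_pos.2 htT).ne'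
      rw [Real.rpow_neg htT.le, ← Real.sqrt_eq_rpow]
      field_simp
      ring
    rw [← e]
    exact h3.hasDerivWithinAt
  have hBcont : ContinuousOn (fun t => 2 * M * (Real.sqrt (T' - t₀) - Real.sqrt (T' - t))) (Icc t₀ b) := by
    fun_prop
  have hf : ContinuousOn (fun t => X t - X t₀) (Icc t₀ b) := hcont.sub continuousOn_const
  have hf' : ∀ t ∈ Ico t₀ b, HasDerivWithinAt (fun t => X t - X t₀) (V t) (Ici t) t :=
    fun t ht => (hderiv t ht).sub_const _
  have h0 : ‖X t₀ - X t₀‖ ≤ 2 * M * (Real.sqrt (T' - t₀) - Real.sqrt (T' - t₀)) := by simp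
  intro t ht
  exact image_norm_le_of_norm_deriv_right_le_deriv_boundary' hf hf' h0 hBcont hB
    (fun s hs => hspeed s hs) ht

/-- **OUTER REGION FROZEN.**  Under the same speed bound, a particle starting at distance
`≥ 4M√(T'−t₀)` from `x₀` stays at distance `≥ 2M√(T'−t₀)` — it never reaches the similarity core, so the
level shells `levelShell` (which start at similarity radius `4M`) are materially disconnected from the
cascade core and from each other's cores.  This is the lever the weak-`L³` gauge lacks. -/
theorem outer_region_frozen {X V : ℝ → (EuclideanSpace ℝ (Fin 3))} {t₀ b T' M : ℝ} (hb : b < T') (hM : 0 ≤ M)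
    (hcont : ContinuousOn X (Icc t₀ b))
    (hderiv : ∀ t ∈ Ico t₀ b, HasDerivWithinAt X (V t) (Ici t) t)
    (hspeed : ∀ t ∈ Ico t₀ b, ‖V t‖ ≤ M * (T' - t) ^ (-(1 / 2 : ℝ)))
    {x₀ : (EuclideanSpace ℝ (Fin 3))} (hfar : 4 * M * Real.sqrt (T' - t₀) ≤ ‖X t₀ - x₀‖) :
    ∀ t ∈ Icc t₀ b, 2 * M * Real.sqrt (T' - t₀) ≤ ‖X t - x₀‖ := by
  intro t ht
  have hdisp := displacement_le_of_speed_le_rate hb hcont hderiv hspeed t ht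
  have hsq : 0 ≤ Real.sqrt (T' - t) := Real.sqrt_nonneg _
  have hdisp' : ‖X t - X t₀‖ ≤ 2 * M * Real.sqrt (T' - t₀) := by
    refine hdisp.trans ?_
    nlinarith
  have htri : ‖X t₀ - x₀‖ ≤ ‖X t - x₀‖ + ‖X t - X t₀‖ := by
    have := norm_sub_le_norm_sub_add_norm_sub (X t₀) (X t) x₀
    rw [norm_sub_rev (X t₀) (X t)] at this
    linarith
  linarith

/-- `√s_j = √t₁ · e^{-a j}`. -/
theorem sqrt_levelScale (a t₁ : ℝ) (j : ℕ) :
    Real.sqrt (levelScale a t₁ j) = Real.sqrt t₁ * Real.exp (-(a * j)) := by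
  have h : Real.exp (-2 * a * j) = Real.exp (-(a * j)) ^ 2 := by
    rw [sq, ← Real.exp_add]; ring_nf
  rw [levelScale, Real.sqrt_mul' _ (Real.exp_nonneg _), h, Real.sqrt_sq (Real.exp_nonneg _)]

/-- The trace shells are measurable (open spherical shells). -/
theorem measurableSet_levelShell (M a t₁ : ℝ) (x₀ : (EuclideanSpace ℝ (Fin 3))) (k : ℕ) :
    MeasurableSet (levelShell M a t₁ x₀ k) := by
  have hf : Measurable fun x : (EuclideanSpace ℝ (Fin 3)) => ‖x - x₀‖ := (measurable_id.sub_const x₀).norm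
  simpa only [levelShell, Set.setOf_and] using
    (measurableSet_lt measurable_const hf).inter (measurableSet_lt hf measurable_const)

/-- **Disjointness of the trace shells of distinct levels** (`M ≥ 1/4`, `a ≥ 0`): shell `j` ends at
radius `e^{a}√s_j = √s_{j-1} ≤ 4M√s_i` for `i < j`. -/
theorem levelShell_disjoint {M a t₁ : ℝ} (hM : 1 / 4 ≤ M) (ha : 0 ≤ a) (x₀ : (EuclideanSpace ℝ (Fin 3))) {i j : ℕ}
    (hij : i < j) : Disjoint (levelShell M a t₁ x₀ i) (levelShell M a t₁ x₀ j) := by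
  rw [Set.disjoint_left]
  rintro x ⟨hxi, -⟩ ⟨-, hxj⟩
  have hle : Real.exp a * Real.sqrt (levelScale a t₁ j) ≤ 4 * M * Real.sqrt (levelScale a t₁ i) := by
    rw [sqrt_levelScale, sqrt_levelScale]
    have hj : (i : ℝ) + 1 ≤ j := by exact_mod_cast Nat.succ_le_of_lt hij
    have h1 : Real.exp a * Real.exp (-(a * j)) ≤ Real.exp (-(a * i)) := by
      rw [← Real.exp_add]
      apply Real.exp_le_exp.2
      have := mul_nonneg ha (sub_nonneg.2 hj)
      nlinarith
    have ht : 0 ≤ Real.sqrt t₁ := Real.sqrt_nonneg _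
    have hpos : 0 ≤ Real.sqrt t₁ * Real.exp (-(a * i)) := mul_nonneg ht (Real.exp_nonneg _)
    calc Real.exp a * (Real.sqrt t₁ * Real.exp (-(a * j)))
        = Real.sqrt t₁ * (Real.exp a * Real.exp (-(a * j))) := by ring
      _ ≤ Real.sqrt t₁ * Real.exp (-(a * i)) := mul_le_mul_of_nonneg_left h1 ht
      _ = 1 * (Real.sqrt t₁ * Real.exp (-(a * i))) := by ring
      _ ≤ 4 * M * (Real.sqrt t₁ * Real.exp (-(a * i))) :=
          mul_le_mul_of_nonneg_right (by linarith) hpos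
  linarith

/-- **THE ACCOUNTING (kernel-checked, v1.2): flare persistence ⇒ the census, `C = 1/c`.**  The bad
levels' shells are pairwise disjoint and each holds `≥ c` of cube trace at time `t₁`, while the whole
slice holds `‖u(t₁)‖₃³ ≤ A³`: `#bad · c ≤ A³`. -/
theorem censusAt_of_flarePersistenceAt {M μ a c : ℝ} (hM : 1 ≤ M) (ha : 0 ≤ a) (hc : 0 < c)
    (h : FlarePersistenceAt M μ a c) : CensusAt M μ a (1 / c) := by
  intro T τ A t₁ x₀ u p n hframe hτ hrate hL3 hA ht₁
  set B := (Finset.range n).filter fun k => ¬ GoodLevel M μ a u t₁ x₀ (k + 1) with hB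
  have hA0 : 0 ≤ A := by linarith
  -- the slice's cube mass
  have hI : ∫⁻ x, ‖u t₁ x‖ₑ ^ (3 : ℝ) ≤ ENNReal.ofReal (A ^ 3) := by
    have hL := hL3 t₁ ⟨ht₁.1.le, ht₁.2⟩
    rw [eLpNorm_eq_lintegral_rpow_enorm_toReal (by norm_num) (by norm_num)] at hL
    simp only [ENNReal.toReal_ofNat] at hL
    have h3 := ENNReal.rpow_le_rpow hL (by norm_num : (0 : ℝ) ≤ 3)
    rw [← ENNReal.rpow_mul, show (1 / 3 : ℝ) * 3 = 1 by norm_num, ENNReal.rpow_one,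
      ENNReal.ofReal_rpow_of_nonneg hA0 (by norm_num : (0 : ℝ) ≤ 3)] at h3
    have hA3 : A ^ (3 : ℝ) = A ^ 3 := by
      rw [show (3 : ℝ) = ((3 : ℕ) : ℝ) by norm_num, Real.rpow_natCast]
    rwa [hA3] at h3
  -- each bad level deposits ≥ c into its own shell
  have hdep : ∀ k ∈ B, ENNReal.ofReal c ≤
      ∫⁻ x in levelShell M a t₁ x₀ (k + 1), ‖u t₁ x‖ₑ ^ (3 : ℝ) := by
    intro k hk
    exact h T τ A t₁ x₀ u p k hframe hτ hrate hL3 hA ht₁ (Finset.mem_filter.1 hk).2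
  -- the shells of distinct bad levels are disjoint
  have hdisj : Set.PairwiseDisjoint (↑B : Set ℕ) (fun k => levelShell M a t₁ x₀ (k + 1)) := by
    intro i _ j _ hne
    change Disjoint (levelShell M a t₁ x₀ (i + 1)) (levelShell M a t₁ x₀ (j + 1))
    have hM4 : 1 / 4 ≤ M := by linarith
    rcases Nat.lt_or_gt_of_ne hne with hlt | hgt
    · exact levelShell_disjoint hM4 ha x₀ (Nat.succ_lt_succ hlt)
    · exact (levelShell_disjoint hM4 ha x₀ (Nat.succ_lt_succ hgt)).symm
  -- sum
  have hsum : (B.card : ℝ≥0∞) * ENNReal.ofReal c ≤ ENNReal.ofReal (A ^ 3) := by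
    calc (B.card : ℝ≥0∞) * ENNReal.ofReal c
        = ∑ k ∈ B, ENNReal.ofReal c := by simp [Finset.sum_const, nsmul_eq_mul]
      _ ≤ ∑ k ∈ B, ∫⁻ x in levelShell M a t₁ x₀ (k + 1), ‖u t₁ x‖ₑ ^ (3 : ℝ) :=
          Finset.sum_le_sum hdep
      _ = ∫⁻ x in ⋃ k ∈ B, levelShell M a t₁ x₀ (k + 1), ‖u t₁ x‖ₑ ^ (3 : ℝ) :=
          (lintegral_biUnion_finset hdisj (fun k _ => measurableSet_levelShell M a t₁ x₀ (k + 1)) _).symm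
      _ ≤ ∫⁻ x, ‖u t₁ x‖ₑ ^ (3 : ℝ) := setLIntegral_le_lintegral _ _
      _ ≤ ENNReal.ofReal (A ^ 3) := hI
  -- back to reals
  have hA3 : 0 ≤ A ^ 3 := by positivity
  have hreal : (B.card : ℝ) * c ≤ A ^ 3 := by
    have h' : ENNReal.ofReal ((B.card : ℝ) * c) ≤ ENNReal.ofReal (A ^ 3) := by
      rwa [ENNReal.ofReal_mul (Nat.cast_nonneg _), ENNReal.ofReal_natCast]
    exact (ENNReal.ofReal_le_ofReal_iff hA3).1 h'
  have hcard : (B.card : ℝ) ≤ A ^ 3 / c := by rw [le_div_iff₀ hc]; exact hreal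
  calc (B.card : ℝ) ≤ A ^ 3 / c := hcard
    _ = 1 / c * A ^ 3 := by ring

/-- **`FlarePersistence → BeadCensus`** (kernel-checked). -/
theorem beadCensus_of_flarePersistence (hF : FlarePersistence) : BeadCensus := by
  intro μ M hμ hM
  obtain ⟨a₀, ha₀, h⟩ := hF μ M hμ hM
  refine ⟨a₀, fun a ha => ?_⟩
  obtain ⟨c, hc, hP⟩ := h a ha
  exact ⟨1 / c, censusAt_of_flarePersistenceAt hM (ha₀.trans ha) hc hP⟩

/-- Counting at fixed large `M`: `n = #good + #bad ≤ A³/c + C A³` levels fit under any violator of size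
`e^{a(n+1)}A^{b}`; with `K := a(1/c + C + 2) + b` a violator of `exp(K A³)` would need more levels. -/
theorem quantCubicExpAt_of_censusAt_of_chainAt {M μ a b c : ℝ} (ha : 0 < a) (hb : 0 ≤ b) (hc : 0 < c)
    (hchain : ChainAt M μ a b c) (hcensus : ∃ C : ℝ, CensusAt M μ a C) : QuantCubicExpAt M := by
  obtain ⟨C, hbad⟩ := hcensus
  -- the census constant may be assumed nonnegative
  set C' : ℝ := max C 0 with hC'
  have hC'0 : 0 ≤ C' := le_max_right _ _
  refine ⟨a * (1 / c + C' + 2) + b, ?_⟩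
  intro T τ A u p hframe hτ htypeI hL3 hA t ht x
  by_contra hviol
  push Not at hviol
  have hA0 : 0 < A := by linarith
  have hA3 : 8 ≤ A ^ 3 := by
    calc (8 : ℝ) = 2 ^ 3 := by norm_num
      _ ≤ A ^ 3 := by gcongr
  -- `log A ≤ A³`
  have hlog : Real.log A ≤ A ^ 3 := by
    have h1 := Real.log_le_sub_one_of_pos hA0
    have h4 : 4 ≤ A ^ 2 := by nlinarith
    have hAA : A ≤ A ^ 3 := by nlinarith
    linarith
  -- the violator in `√t` form
  have ht0 : 0 < t := ht.1
  have hsqrt : 0 < Real.sqrt t := Real.sqrt_pos.2 ht0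
  have hviol' : Real.exp ((a * (1 / c + C' + 2) + b) * A ^ 3) < ‖u t x‖ * Real.sqrt t := by
    have e : t ^ (-(1 / 2 : ℝ)) = (Real.sqrt t)⁻¹ := by
      rw [Real.rpow_neg ht0.le, ← Real.sqrt_eq_rpow]
    rw [e, ← div_eq_mul_inv, div_lt_iff₀ hsqrt] at hviol
    exact hviol
  -- depth `n := ⌊L⌋₊ - 1`, `L := (1/c + C' + 2) A³`, so that `a (n+1) + b log A ≤ K A³`
  set L : ℝ := (1 / c + C' + 2) * A ^ 3 with hL
  have hL1 : 2 ≤ L := by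
    have : (0 : ℝ) ≤ 1 / c + C' := by positivity
    nlinarith
  set n : ℕ := ⌊L⌋₊ - 1 with hn
  have hfloor1 : 1 ≤ ⌊L⌋₊ := Nat.one_le_iff_ne_zero.2 (by
    intro h0
    have := (Nat.floor_eq_zero.1 h0)
    linarith)
  have hn_real : (n : ℝ) = (⌊L⌋₊ : ℝ) - 1 := by
    rw [hn, Nat.cast_sub hfloor1, Nat.cast_one]
  have hn_le : ((n : ℝ) + 1) ≤ L := by
    rw [hn_real]
    have := Nat.floor_le (by linarith : (0 : ℝ) ≤ L)
    linarith
  have hn_ge : L - 2 ≤ (n : ℝ) := by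
    rw [hn_real]
    have := Nat.lt_floor_add_one L
    linarith
  have hexp : Real.exp (a * (n + 1) + b * Real.log A) ≤ ‖u t x‖ * Real.sqrt t := by
    refine le_trans (Real.exp_le_exp.2 ?_) hviol'.le
    have h1 : a * ((n : ℝ) + 1) ≤ a * L := mul_le_mul_of_nonneg_left hn_le ha.le
    have h2 : b * Real.log A ≤ b * A ^ 3 := mul_le_mul_of_nonneg_left hlog hb
    have e : (a * (1 / c + C' + 2) + b) * A ^ 3 = a * L + b * A ^ 3 := by rw [hL]; ring
    linarith
  -- good and bad levels
  have hg := hchain T τ A t x u p n hframe hτ htypeI hL3 hA ht hexp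
  have hb' : (((Finset.range n).filter fun k => ¬ GoodLevel M μ a u t x (k + 1)).card : ℝ) ≤
      C' * A ^ 3 :=
    (hbad T τ A t x u p n hframe hτ htypeI hL3 hA ht).trans
      (mul_le_mul_of_nonneg_right (le_max_left _ _) (by positivity))
  have hsplit : (((Finset.range n).filter fun k => GoodLevel M μ a u t x (k + 1)).card : ℝ) +
      (((Finset.range n).filter fun k => ¬ GoodLevel M μ a u t x (k + 1)).card : ℝ) = n := by
    have h := Finset.card_filter_add_card_filter_not
      (s := Finset.range n) (fun k => GoodLevel M μ a u t x (k + 1))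
    rw [Finset.card_range] at h
    exact_mod_cast h
  have hgood_le : (((Finset.range n).filter fun k => GoodLevel M μ a u t x (k + 1)).card : ℝ) ≤
      A ^ 3 / c := by
    rw [le_div_iff₀ hc]
    exact hg
  -- count: `n ≤ A³/c + C' A³` but `n ≥ L − 2 = A³/c + C' A³ + 2A³ − 2 ≥ A³/c + C' A³ + 14`
  have h1 : (n : ℝ) ≤ A ^ 3 / c + C' * A ^ 3 := by linarith
  have h2 : A ^ 3 / c + C' * A ^ 3 + 14 ≤ (n : ℝ) := by
    have e : L = A ^ 3 / c + C' * A ^ 3 + 2 * A ^ 3 := by rw [hL]; ring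
    linarith
  linarith

/-- **THE RUNG FROM CENSUS + CHAIN (kernel-checked): `BeadCensus → BPChainRate → R`** for every Type-I
constant `M` — large `M` by the counting above at separation `a := max a₀ a₁`, small `M` by
antitonicity. -/
theorem typeIQuantCubicExp_of_beadCensus_of_bpChainRate (hcensus : BeadCensus) (hchain : BPChainRate) :
    TypeIQuantCubicExp := by
  obtain ⟨μ, M₀, b, hμ, hM₀, hb, hlarge⟩ := hchain
  intro M
  obtain ⟨a₁, c, ha₁, hc, hch⟩ := hlarge (max M M₀) (le_max_right _ _)
  obtain ⟨a₀, hcen⟩ := hcensus μ (max M M₀) hμ (hM₀.trans (le_max_right _ _))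
  have ha : 0 < max a₀ a₁ := lt_of_lt_of_le ha₁ (le_max_right _ _)
  exact quantCubicExpAt_antitone (le_max_left M M₀)
    (quantCubicExpAt_of_censusAt_of_chainAt ha hb hc (hch _ (le_max_right _ _))
      (hcen _ (le_max_left _ _)))

/-- `FlarePersistence → BPChainRate → R` (kernel-checked). -/
theorem typeIQuantCubicExp_of_flarePersistence_of_bpChainRate (hF : FlarePersistence)
    (hchain : BPChainRate) : TypeIQuantCubicExp :=
  typeIQuantCubicExp_of_beadCensus_of_bpChainRate (beadCensus_of_flarePersistence hF) hchain

end

end Summit.NavierStokesRegularity.NavierStokesRegularity.Cruxes.TypeIQuantSubcubicExp.BeadCensus
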